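import Mathlib
import HarnessLib
import Summits.CriticalPhenomena.PercolationContinuityZ3.Theses.PercTreeValue
import Summits.CriticalPhenomena.PercolationContinuityZ3.Theorems.PercTreeValueTetrahedronDisjointCoexistenceStubPairSymm
import Summits.CriticalPhenomena.PercolationContinuityZ3.Theorems.PercTreeValueTetrahedronDisjointCoexistenceStubRestrictProduct
import Summits.CriticalPhenomena.PercolationContinuityZ3.Theorems.PercTreeValueTetrahedronDisjointCoexistenceStubRestrictSymm
import Summits.CriticalPhenomena.PercolationContinuityZ3.Theorems.PercTreeValueAssemblyViaDisjointCoexistence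
import Literature.Probability.Percolation.TwoPointFunction

/-!
# Route PercTreeValue — transfer B for the crux `TetrahedronDisjointCoexistence` (stmt-CriticalPhenomena-7798):
# restriction squaring + interface blocking

Line `SketchIdeator2`, composition B (lead prover-line-stmt-CriticalPhenomena-7798-0). With `a_r = (r,r,0)`,
`b_r = (r,0,r)`, `c_r = (0,r,r)`, `H_r = {x | 2x₂ + 2 ≤ r}`, `U_r = {x | r + 2 ≤ 2x₂}`:

* `stub_cruxOfRestrictionBlocking` — if `P(0 ↔ a_r inside H_r) ≥ c₁ τ(0,a_r)` (RESTRICTION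
  POSITIVITY, an increasing-event ratio, plausibly true in every world) and
  `P(0 ↔_{H_r} a_r, b_r ↔_{U_r} c_r, 0 ↮ b_r) ≥ c₂ · P(0 ↔_{H_r} a_r, b_r ↔_{U_r} c_r)` (INTERFACE BLOCKING, continuity-strength),
  then the crux holds with `δ = c₂ c₁²`: the two restricted events are independent (`stub_restrictProduct`, `H_r ∩ U_r = ∅`),
  exchanged by the rotoreflection `φ_r` (`stub_restrictSymm`; `stub_pairSymm` for `τ(b_r,c_r) = τ(0,a_r)`), and restricted
  connections are connections. This is the route header's foreseen split "SlabRestrictionCost → InterfaceBlocking" with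
  half-spaces. Kit j018104 (L = 256–512, lead's `Numerics-interface-j018104.md` in the crux directory): `Res ≈ 0.53`,
  `β ≈ 0.3`, certified share `Res²β ≈ 0.6 d` of `d ≈ 0.14` — against `c² ≈ 10⁻⁵` for confinement squaring (transfer A).
* `percolationContinuityZ3_of_restriction_of_blocking` — composed with the landed `AssemblyViaDisjointCoexistence_proof`,
  the pair settles the conjunct, so interface blocking is crux-sized (false in every jump world).

No new definitions; hypotheses are spelled out over tree declarations exactly as the registered stubs
`stub_restrictionPositivity`, `stub_interfaceBlocking` (both open) of `Cruxes/TetrahedronDisjointCoexistence/Lines/SketchIdeator2.lean`.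
-/

noncomputable section

namespace Summit.CriticalPhenomena.PercolationContinuityZ3.Theorems.TetrahedronDisjointCoexistence

open MeasureTheory
open Literature.Probability.Percolation Literature.Probability.LatticeModels

/-- The half-spaces `H_r = {2x₂ + 2 ≤ r}` and `U_r = {r + 2 ≤ 2x₂}` are disjoint vertex sets. -/
theorem lower_upper_disjoint (r : ℕ) :
    Disjoint {x : Site 3 | 2 * x 2 + 2 ≤ (r : ℤ)} {x : Site 3 | (r : ℤ) + 2 ≤ 2 * x 2} := by
  rw [Set.disjoint_left]
  intro x hx hx'
  simp only [Set.mem_setOf_eq] at hx hx'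
  omega

/-- **Restriction squaring + interface blocking** (composition B of line `SketchIdeator2`; the route's foreseen split
`SlabRestrictionCost → InterfaceBlocking` with half-spaces): RESTRICTION POSITIVITY `P(0 ↔ a_r inside H_r) ≥ c₁ τ(0,a_r)`
and INTERFACE BLOCKING `P(0 ↔_{H_r} a_r, b_r ↔_{U_r} c_r, 0 ↮ b_r) ≥ c₂ P(0 ↔_{H_r} a_r, b_r ↔_{U_r} c_r)` give the crux with
`δ = c₂ c₁²`, because the two restricted events are independent (`stub_restrictProduct`, `H_r ∩ U_r = ∅`), exchanged by
`φ_r` (`stub_restrictSymm`, `stub_pairSymm`), and restricted connections are connections. -/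
theorem stub_cruxOfRestrictionBlocking
    (hRes : ∃ c₁ : ℝ, 0 < c₁ ∧ ∃ r₀ : ℕ, ∀ r : ℕ, r₀ ≤ r →
      c₁ * tau 3 (criticalProbI 3) 0 ![(r : ℤ), (r : ℤ), 0] ≤
        (bondPercolation (zdGraph 3) (criticalProbI 3)).real
          (openConnIn {x : Site 3 | 2 * x 2 + 2 ≤ (r : ℤ)} (0 : Site 3) ![(r : ℤ), (r : ℤ), 0]))
    (hBlock : ∃ c₂ : ℝ, 0 < c₂ ∧ ∃ r₀ : ℕ, ∀ r : ℕ, r₀ ≤ r →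
      c₂ * (bondPercolation (zdGraph 3) (criticalProbI 3)).real
          (openConnIn {x : Site 3 | 2 * x 2 + 2 ≤ (r : ℤ)} (0 : Site 3) ![(r : ℤ), (r : ℤ), 0] ∩
            openConnIn {x : Site 3 | (r : ℤ) + 2 ≤ 2 * x 2} (![(r : ℤ), 0, (r : ℤ)] : Site 3) ![0, (r : ℤ), (r : ℤ)]) ≤
        (bondPercolation (zdGraph 3) (criticalProbI 3)).real
          (openConnIn {x : Site 3 | 2 * x 2 + 2 ≤ (r : ℤ)} (0 : Site 3) ![(r : ℤ), (r : ℤ), 0] ∩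
            openConnIn {x : Site 3 | (r : ℤ) + 2 ≤ 2 * x 2} (![(r : ℤ), 0, (r : ℤ)] : Site 3) ![0, (r : ℤ), (r : ℤ)] ∩
            (openConn (0 : Site 3) ![(r : ℤ), 0, (r : ℤ)])ᶜ)) :
    Theses.PercTreeValue.TetrahedronDisjointCoexistence := by
  unfold Theses.PercTreeValue.TetrahedronDisjointCoexistence
  obtain ⟨c₁, hc₁, r₁, h₁⟩ := hRes
  obtain ⟨c₂, hc₂, r₂, h₂⟩ := hBlock
  refine ⟨c₂ * c₁ ^ 2, by positivity, max r₁ r₂, fun r hr => ?_⟩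
  have hr₁ : r₁ ≤ r := le_trans (le_max_left _ _) hr
  have hr₂ : r₂ ≤ r := le_trans (le_max_right _ _) hr
  obtain ⟨hτ, -⟩ := stub_pairSymm (criticalProbI 3) r
  have hτ' : tau 3 (criticalProbI 3) ![(r : ℤ), 0, (r : ℤ)] ![0, (r : ℤ), (r : ℤ)] =
      tau 3 (criticalProbI 3) 0 ![(r : ℤ), (r : ℤ), 0] := by
    rw [tau_def, tau_def]; exact hτ
  rw [hτ']
  have hA := h₁ r hr₁
  have hB := h₂ r hr₂
  have hind := stub_restrictProduct (zdGraph 3) (criticalProbI 3) (lower_upper_disjoint r)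
    (0 : Site 3) ![(r : ℤ), (r : ℤ), 0] ![(r : ℤ), 0, (r : ℤ)] ![0, (r : ℤ), (r : ℤ)]
  rw [stub_restrictSymm] at hind
  have hτnn : 0 ≤ tau 3 (criticalProbI 3) 0 ![(r : ℤ), (r : ℤ), 0] := tau_nonneg _ _ _
  have hincl : (bondPercolation (zdGraph 3) (criticalProbI 3)).real
      (openConnIn {x : Site 3 | 2 * x 2 + 2 ≤ (r : ℤ)} (0 : Site 3) ![(r : ℤ), (r : ℤ), 0] ∩
        openConnIn {x : Site 3 | (r : ℤ) + 2 ≤ 2 * x 2} (![(r : ℤ), 0, (r : ℤ)] : Site 3) ![0, (r : ℤ), (r : ℤ)] ∩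
        (openConn (0 : Site 3) ![(r : ℤ), 0, (r : ℤ)])ᶜ) ≤
      (bondPercolation (zdGraph 3) (criticalProbI 3)).real
      (openConn 0 ![(r : ℤ), (r : ℤ), 0] ∩ openConn ![(r : ℤ), 0, (r : ℤ)] ![0, (r : ℤ), (r : ℤ)] ∩
        (openConn (0 : Site 3) ![(r : ℤ), 0, (r : ℤ)])ᶜ) := by
    refine measureReal_mono ?_
    rintro ω ⟨⟨h1, h2⟩, h3⟩
    exact ⟨⟨openConnIn_subset_openConn _ _ _ h1, openConnIn_subset_openConn _ _ _ h2⟩, h3⟩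
  calc c₂ * c₁ ^ 2 * tau 3 (criticalProbI 3) 0 ![(r : ℤ), (r : ℤ), 0] *
        tau 3 (criticalProbI 3) 0 ![(r : ℤ), (r : ℤ), 0]
      = c₂ * ((c₁ * tau 3 (criticalProbI 3) 0 ![(r : ℤ), (r : ℤ), 0]) *
          (c₁ * tau 3 (criticalProbI 3) 0 ![(r : ℤ), (r : ℤ), 0])) := by ring
    _ ≤ c₂ * ((bondPercolation (zdGraph 3) (criticalProbI 3)).real
            (openConnIn {x : Site 3 | 2 * x 2 + 2 ≤ (r : ℤ)} (0 : Site 3) ![(r : ℤ), (r : ℤ), 0]) *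
          (bondPercolation (zdGraph 3) (criticalProbI 3)).real
            (openConnIn {x : Site 3 | 2 * x 2 + 2 ≤ (r : ℤ)} (0 : Site 3) ![(r : ℤ), (r : ℤ), 0])) :=
        mul_le_mul_of_nonneg_left (mul_le_mul hA hA (by positivity) measureReal_nonneg) hc₂.le
    _ = c₂ * (bondPercolation (zdGraph 3) (criticalProbI 3)).real
          (openConnIn {x : Site 3 | 2 * x 2 + 2 ≤ (r : ℤ)} (0 : Site 3) ![(r : ℤ), (r : ℤ), 0] ∩
            openConnIn {x : Site 3 | (r : ℤ) + 2 ≤ 2 * x 2} (![(r : ℤ), 0, (r : ℤ)] : Site 3) ![0, (r : ℤ), (r : ℤ)]) := by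
        rw [hind]
    _ ≤ _ := hB
    _ ≤ _ := hincl

/-- Restriction positivity together with interface blocking settles the conjunct `θ(p_c(ℤ³)) = 0`. -/
theorem percolationContinuityZ3_of_restriction_of_blocking
    (hRes : ∃ c₁ : ℝ, 0 < c₁ ∧ ∃ r₀ : ℕ, ∀ r : ℕ, r₀ ≤ r →
      c₁ * tau 3 (criticalProbI 3) 0 ![(r : ℤ), (r : ℤ), 0] ≤
        (bondPercolation (zdGraph 3) (criticalProbI 3)).real
          (openConnIn {x : Site 3 | 2 * x 2 + 2 ≤ (r : ℤ)} (0 : Site 3) ![(r : ℤ), (r : ℤ), 0]))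
    (hBlock : ∃ c₂ : ℝ, 0 < c₂ ∧ ∃ r₀ : ℕ, ∀ r : ℕ, r₀ ≤ r →
      c₂ * (bondPercolation (zdGraph 3) (criticalProbI 3)).real
          (openConnIn {x : Site 3 | 2 * x 2 + 2 ≤ (r : ℤ)} (0 : Site 3) ![(r : ℤ), (r : ℤ), 0] ∩
            openConnIn {x : Site 3 | (r : ℤ) + 2 ≤ 2 * x 2} (![(r : ℤ), 0, (r : ℤ)] : Site 3) ![0, (r : ℤ), (r : ℤ)]) ≤
        (bondPercolation (zdGraph 3) (criticalProbI 3)).real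
          (openConnIn {x : Site 3 | 2 * x 2 + 2 ≤ (r : ℤ)} (0 : Site 3) ![(r : ℤ), (r : ℤ), 0] ∩
            openConnIn {x : Site 3 | (r : ℤ) + 2 ≤ 2 * x 2} (![(r : ℤ), 0, (r : ℤ)] : Site 3) ![0, (r : ℤ), (r : ℤ)] ∩
            (openConn (0 : Site 3) ![(r : ℤ), 0, (r : ℤ)])ᶜ)) :
    _root_.PercolationContinuityZ3 := by
  have hA := AssemblyViaDisjointCoexistence_proof
  unfold Theses.PercTreeValue.AssemblyViaDisjointCoexistence at hA
  exact hA (stub_cruxOfRestrictionBlocking hRes hBlock)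

end Summit.CriticalPhenomena.PercolationContinuityZ3.Theorems.TetrahedronDisjointCoexistence

end
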